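import Summits.BirchSwinnertonDyer.BirchSwinnertonDyer.Theses.CumulativeHeegnerLeopoldt
import Summits.BirchSwinnertonDyer.BirchSwinnertonDyer.Theorems.UniversalToricDescentToricTransportModThreeFlatGlue
import HarnessLib

/-!
# Route `CumulativeHeegnerLeopoldt`, crux K2 `EisensteinCharacterInvariantsAtThree` (stmt-BirchSwinnertonDyer-24199),
# line `birth` (skeleton `7ff6adfe04f0…`): the HALF `λ_alg ≤ λ_an` of `stub_lambdaComparison` IS FREE UNDER K1 —
# HELPER (`--supports 24199`), lead prover bsd-line-chl-p1 g7

The K2 line's third registered stub `stub_lambdaComparison` says: at every frame, if `Ch_Λ(X_{∅,0}(𝔭′))·R₀⟦T⟧ = (g)`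
with `g` of norm profile `n` (`‖g_i‖ < 1` for `i < n`, `‖g_n‖ = 1`) and the BDP measure `L` has norm profile `n′`,
then `n = n′` (`λ_alg = λ_an`). The refuter vet (bsd-vet-tk5h g5, finding F3, evidence `V5.lean` §2 on 24199)
kernel-checked in a scratch namespace that ONE inequality is free under crux K1 `CumulativeHeegnerInclusionAtThree`
(`(L) ⊆ Ch·R₀⟦T⟧`): `g ∣ L` and the ultrametric inequality give `n ≤ n′`. This file LANDS that as importable theorems:

* §1 (pure algebra in `R₀⟦T⟧ = 𝒪_{ℂ₃}^{unr}⟦T⟧`, any prime `p`) `normProfileIndex_le_of_span_le` — inclusion of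
  principal ideals is MONOTONE in the profile index (the Weierstrass degree); the divisibility form is the tree's
  `UniversalToricDescentActDFlatGlue.firstUnitCoeff_le_of_dvd` (UTD act D), cited, not restated.
* §2 `normProfileIndex_le_of_cumulativeHeegnerInclusionAtThree` — K1 BY NAME ⟹ the `≤` half of
  `stub_lambdaComparison` at every frame (binders VERBATIM, conclusion `n ≤ n′`);
  `stub_lambdaComparison_of_cumulativeHeegnerInclusionAtThree_of_ge` — the registered stub (signature VERBATIM as
  conclusion) from K1 BY NAME and the reverse inequality `n′ ≤ n` (binders VERBATIM, displayed as hypothesis `hge`).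

So, given K1, the K2 line's `stub_lambdaComparison` IS the single inequality `λ_an ≤ λ_alg` (the Eisenstein
congruence direction); with `stub_algebraicLambdaMuZero` ⟸ B1 (companion file `…AlgebraicHalfOfResidualFinite`) the
K2 line's content beyond B1 and K1 is exactly `μ(ℒ_𝔭^{BDP}) = 0` and `λ_an ≤ λ_alg`. The equality of ideals then is
the tree's `UniversalToricDescentNormProfile.eq_span_of_span_le_of_normProfile` (used by the route kernel).

THEOREMS ONLY; no definition, no named fact, no `sorry`; nothing is asserted about K1. BSD is not proved by any of this.

References: [Washington1997] §7.1 (Weierstrass preparation, distinguished polynomials; the degree is additive);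
evidence V5.lean of bsd-vet-tk5h g5 on stmt-BirchSwinnertonDyer-24199 (finding F3, re-proved here against the tree).
-/

set_option autoImplicit false
set_option linter.dupNamespace false -- `Summit.BirchSwinnertonDyer.BirchSwinnertonDyer.Theorems.…` (summit = sub)

noncomputable section

open scoped Classical

namespace Summit.BirchSwinnertonDyer.BirchSwinnertonDyer.Theorems.EisensteinCharacterInvariantsAtThreeLambdaHalf

open PowerSeries NumberField IsDedekindDomain Field
  Literature.NumberTheory.EllipticCurves
  Summit.BirchSwinnertonDyer.Rank1Residual.X11b Summit.BirchSwinnertonDyer.Rank1Residual.X11b.AcSelmer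
  Summit.BirchSwinnertonDyer.BirchSwinnertonDyer.Theorems.UniversalToricDescentNormProfile
  Summit.BirchSwinnertonDyer.BirchSwinnertonDyer.Theorems.UniversalToricDescentActDFlatGlue
  Summit.BirchSwinnertonDyer.BirchSwinnertonDyer.Theses.CumulativeHeegnerLeopoldt

/-! ### §1 The profile index is monotone under divisibility in `R₀⟦T⟧` -/

section NormProfile

variable {p : ℕ} [Fact p.Prime]

/-- **The profile index is monotone under inclusion of principal ideals**: `(L) ⊆ I = (g)`, `g` without unit
coefficient below `n`, `‖L_{n′}‖ = 1` ⟹ `n ≤ n′` (`g ∣ L`, then the tree's `firstUnitCoeff_le_of_dvd`: a divisor's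
Weierstrass degree is at most the multiple's, ultrametric). Cf. evidence V5.lean §2 (`index_le_of_span_le`). [folklore] -/
theorem normProfileIndex_le_of_span_le {I : Ideal (UnrSeries p)} {g L : UnrSeries p} {n n' : ℕ}
    (hI : I = Ideal.span {g}) (hle : Ideal.span {L} ≤ I)
    (hg : ∀ i < n, ‖((PowerSeries.coeff i g : unrIntegers p) : ℂ_[p])‖ < 1)
    (hL : ‖((PowerSeries.coeff n' L : unrIntegers p) : ℂ_[p])‖ = 1) : n ≤ n' := by
  subst hI
  exact firstUnitCoeff_le_of_dvd (Ideal.mem_span_singleton.mp (hle (Ideal.mem_span_singleton_self L))) hg hL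

end NormProfile

/-! ### §2 K1 BY NAME ⟹ the `≤` half of the K2-line's `stub_lambdaComparison`; the stub from the `≥` half -/

/-- **`λ_alg ≤ λ_an` on the Leopoldt cell from crux K1 `CumulativeHeegnerInclusionAtThree` BY NAME**: at every frame,
if `Ch_Λ(X_{∅,0}(𝔭′))·R₀⟦T⟧ = (g)` with `g` of norm profile `n` and the BDP measure `L` has norm profile `n′`, then
`n ≤ n′` — the binders are those of the registered stub `stub_lambdaComparison` VERBATIM, the conclusion is its `≤`
half (K1 gives `(L) ⊆ (g)`, then §1). Nothing is asserted about K1. [folklore] -/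
theorem normProfileIndex_le_of_cumulativeHeegnerInclusionAtThree (h1 : CumulativeHeegnerInclusionAtThree) :
    ∀ (W : WeierstrassCurve ℚ) [W.IsElliptic] [W.IsGloballyMinimal] (N : ℕ) [NeZero N] (K : Type) [Field K] [NumberField K] (Dt : Literature.NumberTheory.EllipticCurves.ModularForms.ModularParametrizationData W N), Summit.BirchSwinnertonDyer.Rank1Residual.Additive.ClassO6 W 3 → Literature.NumberTheory.EllipticCurves.Rank1Residual.Red W 3 → (∃ Φ : AddSubgroup (WeierstrassCurve.geomTorsion W ((3 : ℕ) : ℤ)), Literature.NumberTheory.EllipticCurves.Rank1Residual.IsRationalLine W 3 Φ ∧ ∀ (v : IsDedekindDomain.HeightOneSpectrum (NumberField.RingOfIntegers ℚ)), ((3 : ℕ) : NumberField.RingOfIntegers ℚ) ∈ v.asIdeal → ∀ 𝔓 ∈ v.primesAbove, ¬ (∀ g ∈ 𝔓.decompositionSubgroup (Field.absoluteGaloisGroup ℚ), ∀ P ∈ Φ, g • P = P) ∧ ¬ (∀ g ∈ 𝔓.decompositionSubgroup (Field.absoluteGaloisGroup ℚ), ∀ P : WeierstrassCurve.geomTorsion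 W ((3 : ℕ) : ℤ), g • P - P ∈ Φ)) → W.analyticRank = 1 → W.conductorNorm ℤ = N → Literature.NumberTheory.EllipticCurves.IsImaginaryQuadratic K → Literature.NumberTheory.EllipticCurves.SatisfiesHeegnerHypothesis N K → ∀ (κ : Literature.NumberTheory.EllipticCurves.ZpExtension K 3), κ.IsAnticyclotomic → ∀ (γ : Field.absoluteGaloisGroup K) [Fact (κ.IsTopGenerator γ)] (𝔭 : IsDedekindDomain.HeightOneSpectrum (NumberField.RingOfIntegers K)), ((3 : ℕ) : NumberField.RingOfIntegers K) ∈ 𝔭.asIdeal → 𝔭.asIdeal.ramificationIdx (NumberField.RingOfIntegers ℚ) = 1 → 𝔭.asIdeal.inertiaDeg (NumberField.RingOfIntegers ℚ) = 1 → ∀ (𝔭' : IsDedekindDomain.HeightOneSpectrum (NumberField.RingOfIntegers K)), ((3 : ℕ) : NumberField.RingOfIntegers K) ∈ 𝔭'.asIdeal → 𝔭' ≠ 𝔭 → ∀ (ι' : PadicAlgCl 3 ≃+* ℂ), Summit.BirchSwinnertonDyer.BirchSwinnertonDyer.Theorems.SchneiderFree.BranchInducesPrime 3 ι' 𝔭 →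 ∀ (ΩK : ℂ) (Ωp : ℂ_[3]) (L : Literature.NumberTheory.EllipticCurves.UnrSeries 3), ΩK ≠ 0 → Ωp ≠ 0 → Literature.NumberTheory.EllipticCurves.IsBDPLFunction ι' 𝔭 κ γ Dt.f ΩK Ωp L → ∀ (g : Literature.NumberTheory.EllipticCurves.UnrSeries 3) (n n' : ℕ), (Summit.BirchSwinnertonDyer.Rank1Residual.X11b.AcSelmer.XAc.charIdeal (W.baseChange K) 3 κ 𝔭' ∅ γ).map (PowerSeries.map (Summit.BirchSwinnertonDyer.Rank1Residual.X11b.Halves.toUnr 3)) = Ideal.span {g} → (∀ i < n, ‖((PowerSeries.coeff i g : Literature.NumberTheory.EllipticCurves.unrIntegers 3) : ℂ_[3])‖ < 1) → ‖((PowerSeries.coeff n g : Literature.NumberTheory.EllipticCurves.unrIntegers 3) : ℂ_[3])‖ = 1 → (∀ i < n', ‖((PowerSeries.coeff i L : Literature.NumberTheory.EllipticCurves.unrIntegers 3) : ℂ_[3])‖ < 1) → ‖((PowerSeries.coeff n' L : Literature.NumberTheory.EllipticCurves.unrIntegers 3) : ℂ_[3])‖ = 1 → n ≤ n' := by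
  intro W _ _ N _ K _ _ Dt hO6 hRed hcell hr hN hK hHg κ hκ γ _ 𝔭 h𝔭 he hf 𝔭' h𝔭' hne ι' hι ΩK Ωp L hΩK hΩp hBDP
    g n n' hg hgn _hgu _hLn hLu
  exact normProfileIndex_le_of_span_le hg
    (h1 W N K Dt hO6 hRed hcell hr hN hK hHg κ hκ γ 𝔭 h𝔭 he hf 𝔭' h𝔭' hne ι' hι ΩK Ωp L hΩK hΩp hBDP) hgn hLu

/-- **K2-line stub `stub_lambdaComparison` (skeleton `7ff6adfe04f0…`, signature VERBATIM as conclusion) from crux K1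
BY NAME and the reverse inequality `λ_an ≤ λ_alg`** (binders VERBATIM, conclusion `n′ ≤ n`, displayed as hypothesis
`hge`): given K1, the stub's content is that single inequality. Nothing is asserted about K1 or `hge`. [folklore] -/
theorem stub_lambdaComparison_of_cumulativeHeegnerInclusionAtThree_of_ge (h1 : CumulativeHeegnerInclusionAtThree)
    (hge : ∀ (W : WeierstrassCurve ℚ) [W.IsElliptic] [W.IsGloballyMinimal] (N : ℕ) [NeZero N] (K : Type) [Field K] [NumberField K] (Dt : Literature.NumberTheory.EllipticCurves.ModularForms.ModularParametrizationData W N), Summit.BirchSwinnertonDyer.Rank1Residual.Additive.ClassO6 W 3 → Literature.NumberTheory.EllipticCurves.Rank1Residual.Red W 3 → (∃ Φ : AddSubgroup (WeierstrassCurve.geomTorsion W ((3 : ℕ) : ℤ)), Literature.NumberTheory.EllipticCurves.Rank1Residual.IsRationalLine W 3 Φ ∧ ∀ (v : IsDedekindDomain.HeightOneSpectrum (NumberField.RingOfIntegers ℚ)), ((3 : ℕ) : NumberField.RingOfIntegers ℚ) ∈ v.asIdeal → ∀ 𝔓 ∈ v.primesAbove, ¬ (∀ g ∈ 𝔓.decompositionSubgroup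 (Field.absoluteGaloisGroup ℚ), ∀ P ∈ Φ, g • P = P) ∧ ¬ (∀ g ∈ 𝔓.decompositionSubgroup (Field.absoluteGaloisGroup ℚ), ∀ P : WeierstrassCurve.geomTorsion W ((3 : ℕ) : ℤ), g • P - P ∈ Φ)) → W.analyticRank = 1 → W.conductorNorm ℤ = N → Literature.NumberTheory.EllipticCurves.IsImaginaryQuadratic K → Literature.NumberTheory.EllipticCurves.SatisfiesHeegnerHypothesis N K → ∀ (κ : Literature.NumberTheory.EllipticCurves.ZpExtension K 3), κ.IsAnticyclotomic → ∀ (γ : Field.absoluteGaloisGroup K) [Fact (κ.IsTopGenerator γ)] (𝔭 : IsDedekindDomain.HeightOneSpectrum (NumberField.RingOfIntegers K)), ((3 : ℕ) : NumberField.RingOfIntegers K) ∈ 𝔭.asIdeal → 𝔭.asIdeal.ramificationIdx (NumberField.RingOfIntegers ℚ) = 1 → 𝔭.asIdeal.inertiaDeg (NumberField.RingOfIntegers ℚ) = 1 → ∀ (𝔭' : IsDedekindDomain.HeightOneSpectrum (NumberField.RingOfIntegers K)), ((3 : ℕ) : NumberField.RingOfIntegers K) ∈ 𝔭'.asIdeal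 → 𝔭' ≠ 𝔭 → ∀ (ι' : PadicAlgCl 3 ≃+* ℂ), Summit.BirchSwinnertonDyer.BirchSwinnertonDyer.Theorems.SchneiderFree.BranchInducesPrime 3 ι' 𝔭 → ∀ (ΩK : ℂ) (Ωp : ℂ_[3]) (L : Literature.NumberTheory.EllipticCurves.UnrSeries 3), ΩK ≠ 0 → Ωp ≠ 0 → Literature.NumberTheory.EllipticCurves.IsBDPLFunction ι' 𝔭 κ γ Dt.f ΩK Ωp L → ∀ (g : Literature.NumberTheory.EllipticCurves.UnrSeries 3) (n n' : ℕ), (Summit.BirchSwinnertonDyer.Rank1Residual.X11b.AcSelmer.XAc.charIdeal (W.baseChange K) 3 κ 𝔭' ∅ γ).map (PowerSeries.map (Summit.BirchSwinnertonDyer.Rank1Residual.X11b.Halves.toUnr 3)) = Ideal.span {g} → (∀ i < n, ‖((PowerSeries.coeff i g : Literature.NumberTheory.EllipticCurves.unrIntegers 3) : ℂ_[3])‖ < 1) → ‖((PowerSeries.coeff n g : Literature.NumberTheory.EllipticCurves.unrIntegers 3) : ℂ_[3])‖ = 1 → (∀ i < n', ‖((PowerSeries.coeff i L : Literature.NumberTheory.EllipticCurves.unrIntegers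 3) : ℂ_[3])‖ < 1) → ‖((PowerSeries.coeff n' L : Literature.NumberTheory.EllipticCurves.unrIntegers 3) : ℂ_[3])‖ = 1 → n' ≤ n) :
    ∀ (W : WeierstrassCurve ℚ) [W.IsElliptic] [W.IsGloballyMinimal] (N : ℕ) [NeZero N] (K : Type) [Field K] [NumberField K] (Dt : Literature.NumberTheory.EllipticCurves.ModularForms.ModularParametrizationData W N), Summit.BirchSwinnertonDyer.Rank1Residual.Additive.ClassO6 W 3 → Literature.NumberTheory.EllipticCurves.Rank1Residual.Red W 3 → (∃ Φ : AddSubgroup (WeierstrassCurve.geomTorsion W ((3 : ℕ) : ℤ)), Literature.NumberTheory.EllipticCurves.Rank1Residual.IsRationalLine W 3 Φ ∧ ∀ (v : IsDedekindDomain.HeightOneSpectrum (NumberField.RingOfIntegers ℚ)), ((3 : ℕ) : NumberField.RingOfIntegers ℚ) ∈ v.asIdeal → ∀ 𝔓 ∈ v.primesAbove, ¬ (∀ g ∈ 𝔓.decompositionSubgroup (Field.absoluteGaloisGroup ℚ), ∀ P ∈ Φ, g • P = P) ∧ ¬ (∀ g ∈ 𝔓.decompositionSubgroup (Field.absoluteGaloisGroup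 ℚ), ∀ P : WeierstrassCurve.geomTorsion W ((3 : ℕ) : ℤ), g • P - P ∈ Φ)) → W.analyticRank = 1 → W.conductorNorm ℤ = N → Literature.NumberTheory.EllipticCurves.IsImaginaryQuadratic K → Literature.NumberTheory.EllipticCurves.SatisfiesHeegnerHypothesis N K → ∀ (κ : Literature.NumberTheory.EllipticCurves.ZpExtension K 3), κ.IsAnticyclotomic → ∀ (γ : Field.absoluteGaloisGroup K) [Fact (κ.IsTopGenerator γ)] (𝔭 : IsDedekindDomain.HeightOneSpectrum (NumberField.RingOfIntegers K)), ((3 : ℕ) : NumberField.RingOfIntegers K) ∈ 𝔭.asIdeal → 𝔭.asIdeal.ramificationIdx (NumberField.RingOfIntegers ℚ) = 1 → 𝔭.asIdeal.inertiaDeg (NumberField.RingOfIntegers ℚ) = 1 → ∀ (𝔭' : IsDedekindDomain.HeightOneSpectrum (NumberField.RingOfIntegers K)), ((3 : ℕ) : NumberField.RingOfIntegers K) ∈ 𝔭'.asIdeal → 𝔭' ≠ 𝔭 → ∀ (ι' : PadicAlgCl 3 ≃+* ℂ), Summit.BirchSwinnertonDyer.BirchSwinnertonDyer.Theorems.SchneiderFree.BranchInducesPrime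 3 ι' 𝔭 → ∀ (ΩK : ℂ) (Ωp : ℂ_[3]) (L : Literature.NumberTheory.EllipticCurves.UnrSeries 3), ΩK ≠ 0 → Ωp ≠ 0 → Literature.NumberTheory.EllipticCurves.IsBDPLFunction ι' 𝔭 κ γ Dt.f ΩK Ωp L → ∀ (g : Literature.NumberTheory.EllipticCurves.UnrSeries 3) (n n' : ℕ), (Summit.BirchSwinnertonDyer.Rank1Residual.X11b.AcSelmer.XAc.charIdeal (W.baseChange K) 3 κ 𝔭' ∅ γ).map (PowerSeries.map (Summit.BirchSwinnertonDyer.Rank1Residual.X11b.Halves.toUnr 3)) = Ideal.span {g} → (∀ i < n, ‖((PowerSeries.coeff i g : Literature.NumberTheory.EllipticCurves.unrIntegers 3) : ℂ_[3])‖ < 1) → ‖((PowerSeries.coeff n g : Literature.NumberTheory.EllipticCurves.unrIntegers 3) : ℂ_[3])‖ = 1 → (∀ i < n', ‖((PowerSeries.coeff i L : Literature.NumberTheory.EllipticCurves.unrIntegers 3) : ℂ_[3])‖ < 1) → ‖((PowerSeries.coeff n' L : Literature.NumberTheory.EllipticCurves.unrIntegers 3) : ℂ_[3])‖ = 1 →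 n = n' := by
  intro W _ _ N _ K _ _ Dt hO6 hRed hcell hr hN hK hHg κ hκ γ _ 𝔭 h𝔭 he hf 𝔭' h𝔭' hne ι' hι ΩK Ωp L hΩK hΩp hBDP
    g n n' hg hgn hgu hLn hLu
  exact le_antisymm
    (normProfileIndex_le_of_cumulativeHeegnerInclusionAtThree h1 W N K Dt hO6 hRed hcell hr hN hK hHg κ hκ γ 𝔭 h𝔭
      he hf 𝔭' h𝔭' hne ι' hι ΩK Ωp L hΩK hΩp hBDP g n n' hg hgn hgu hLn hLu)
    (hge W N K Dt hO6 hRed hcell hr hN hK hHg κ hκ γ 𝔭 h𝔭 he hf 𝔭' h𝔭' hne ι' hι ΩK Ωp L hΩK hΩp hBDP g n n' hg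
      hgn hgu hLn hLu)

end Summit.BirchSwinnertonDyer.BirchSwinnertonDyer.Theorems.EisensteinCharacterInvariantsAtThreeLambdaHalf

end
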